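import Summits.ResolutionOfSingularities.ResolutionOfSingularities.Theorems.HilbertSamuelEliminationSigmaMaxModificationsCorridor3WLadderIsoTailsFrameCompletionIso
import Summits.ResolutionOfSingularities.ResolutionOfSingularities.Theorems.HilbertSamuelEliminationSigmaMaxModificationsCorridor3WLadderIsoTailsArcLimitBennett
import Summits.ResolutionOfSingularities.ResolutionOfSingularities.Theorems.HilbertSamuelEliminationSigmaMaxModificationsCorridor3WLadderIsoTailsArcShearConjugation
import HarnessLib

/-!
# [OURS · L1 W4.2] D14 ROUTE G v2 «ARC LIMIT» — object G2f, part 2: **THE RING-LEVEL TOWER GLUE** — from a tower of formal frames with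
# kernel links (G2a ⊇-half + `t`-saturation + frame commutation) to lead-1's limit inequality G2c: Bennett's equality along the sheared
# arc for the formal model of the BASE stage
# (crux `SigmaMaxModifications` stmt-ResolutionOfSingularities-18506 / conjunct stmt-…-19249; kernel K1
# `IdeasL1C5.IsoFreeRationalTailsImpossible` in every embedding dimension; res-L1-w42-lead-1 `ROUTE-G-ARCLIMIT.md` §1/§4 G2f;
# res-type-071 2026-08-27T15:01:06Z «the consumer then iterates [G2a-FL] over ℕ and feeds G2c through my G2b»)

Prover res-L1-w42-stub-2 (gen 5), G2f FINAL ASSEMBLY (taken 2026-08-27T15:13:46Z, left by res-type-001). Helper file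
`--supports stmt-ResolutionOfSingularities-19249 --as helper`; kernel only, no definitions, no named fact. OURS (cell res-hironaka, slot W4.2);
NOT statements of [Hironaka2017] nor of [CossartJannsenSaito2020] / [CossartPiltant2009]. AI-written; AI review is weaker than expert review.

## The glue (ring level — no schemes in this file)

DATA (what the ℕ-iteration of the free-rational frame step delivers, res-D-pv-010 `exists_frameStep` / res-type-071 G2a-FL, read abstractly):
for every `n`, a regular local ring `R_n` of embedding dimension `d + 1` with a regular system of parameters `x_n`, a presentation
`σ_n : R_n ↠ A_n` of a Noetherian local ring (the stalk `𝒪_{X_n,x_n}`) whose kernel is `x_n 0`-SATURATED (`x_n 0 = t`, the exceptional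
parameter: `t` is a nonzerodivisor of `𝒪_{X_n,x_n}`), a frame `ψ_n : R_n → S = K⟦X_0, …, X_d⟧` (local, `ψ_n (x_n 0) = X 0`,
`ψ_n (x_n i) ≡ X i + λ_{n,i} X 0 (mod 𝔪²)`, onto on residue fields), links `ι_n : R_n → R_{n+1}` and translations `c` with the FRAME
COMMUTATION `ψ_{n+1} ∘ ι_n = (y ↦ t(y + c_{n+1})) ∘ ψ_n` and the KERNEL LINK `ι_n(ker σ_n) ⊆ ker σ_{n+1}` (G2a, ⊇-half), and NEARNESS
`H^{(0)}(A_n) = H^{(0)}(A_0)`.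

CONCLUSION (`exists_bennettArc_of_frameTower`): with `J := θ_0(ψ_0(ker σ_0)·S)` the SHEARED formal equations of the base stage
(`θ_0` = lead-1's shear by the arc `Σ_k c_k t^k`, res-type-071 G2b) and `P₀ = (X_1, …, X_d)` the arc prime: `S ⧸ J` is local and
`≃ Â_0`, `J ⊆ P₀`, `P₀/J` is prime, and BENNETT'S EQUALITY `H^{(1)}[(S/J)_{P₀/J}] = H^{(0)}[S/J]` holds — verbatim the inputs
`(J, e′, P, hJP, hH)` of res-type-001's `IsoTailsHS.false_of_isIsoPointTower_of_stage_of_bennettArc` (p533299) with `P := P₀`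
(`ArcLimit.isRegularLocalRing_quotient_arcIdeal`, `ArcLimit.ringKrullDim_quotient_arcIdeal`).

PROOF = bookkeeping over landed theorems: the composite steps `T_n = substHom c_n ∘ ⋯ ∘ substHom c_1` carry `ψ_0(ker σ_0)S` into
`ψ_n(ker σ_n)S` (frame commutation + kernel link, induction on `n`); part 1 (`…IsoTailsFrameCompletionIso`) turns each frame into Cohen
coordinates, giving at every stage the local ring / Hilbert function / `t`-saturation of `ψ_n(ker σ_n)S`; res-type-071's G2b
(`SeriesGen.subst_scale_mem_map_shear`, `colon_X_zero_map_shear`, `nonempty_ringEquiv_quotient_map_shear`) transports these to the sheared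
ideals `Jn n := θ_n(ψ_n(ker σ_n)S)` and supplies `hscale`; lead-1's G2c (`ArcLimit.le_arcIdeal_of_tower`, `ArcLimit.hilbertSamuelFun_arcLimit`)
concludes; the formal model of `J` is res-type-001's `nonempty_frameModelEquiv_map_of_surjective`.

[OURS · L1 W4.2; AI-written] [cite: CossartPiltant2009, ch. 3 I.9] [cite: HerrmannIkedaOrbanz1988, Thm. (22.24), Prop. (30.1)]
-/

set_option linter.dupNamespace false

noncomputable section

open IsLocalRing MvPowerSeries
open Literature.AlgebraicGeometry.Resolution Literature.RingTheory.HilbertSamuel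
open Summit.ResolutionOfSingularities.ResolutionOfSingularities.Cruxes.SigmaMaxModifications.IdeasL1C5

namespace Summit.ResolutionOfSingularities.ResolutionOfSingularities.Theorems.SigmaMaxModificationsCorridor3.IsoTailsHS

universe u

/-! ## §1. Two bookkeeping lemmas -/

/-- The cotangent hypothesis of part 1 from the frame clauses of the tower (`ψ (x 0) = X 0`, `ψ (x i) ≡ X i + λ_i X 0 (mod 𝔪²)`).
[folklore] -/
theorem maximalIdeal_le_map_sup_sq_of_rsop {R : Type u} [CommRing R] [IsLocalRing R] {d : ℕ} (x : Fin (d + 1) → R)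
    (hx : Ideal.span (Set.range x) = maximalIdeal R) {K : Type u} [Field K] (ψ : R →+* MvPowerSeries (Fin (d + 1)) K)
    (hψ0 : ψ (x 0) = X 0) (lam : Fin (d + 1) → K)
    (hψi : ∀ i, i ≠ 0 → ψ (x i) - X i - C (lam i) * X 0 ∈ maximalIdeal (MvPowerSeries (Fin (d + 1)) K) ^ 2) :
    maximalIdeal (MvPowerSeries (Fin (d + 1)) K) ≤ (maximalIdeal R).map ψ ⊔ maximalIdeal (MvPowerSeries (Fin (d + 1)) K) ^ 2 := by
  have hxm : ∀ i, x i ∈ maximalIdeal R := fun i => by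
    rw [← hx]; exact Ideal.subset_span ⟨i, rfl⟩
  have hX0 : (X 0 : MvPowerSeries (Fin (d + 1)) K) ∈ (maximalIdeal R).map ψ := by
    rw [← hψ0]; exact Ideal.mem_map_of_mem ψ (hxm 0)
  have hXi : ∀ i, (X i : MvPowerSeries (Fin (d + 1)) K) ∈
      (maximalIdeal R).map ψ ⊔ maximalIdeal (MvPowerSeries (Fin (d + 1)) K) ^ 2 := by
    intro i
    by_cases hi : i = 0
    · subst hi; exact Ideal.mem_sup_left hX0
    · have e : (X i : MvPowerSeries (Fin (d + 1)) K) = (ψ (x i) - C (lam i) * X 0) - (ψ (x i) - X i - C (lam i) * X 0) := by ring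
      rw [e]
      exact Ideal.sub_mem _ (Ideal.mem_sup_left (Ideal.sub_mem _ (Ideal.mem_map_of_mem ψ (hxm i))
        (Ideal.mul_mem_left _ _ hX0))) (Ideal.mem_sup_right (hψi i hi))
  exact (maximalIdeal_mvPowerSeries_eq_span K (Fin (d + 1))).le.trans (Ideal.span_le.mpr (by rintro _ ⟨i, rfl⟩; exact hXi i))

/-- Sheared ideals only depend on the translation sequence (rewriting under the `HasSubst` proof). [folklore] -/
theorem map_shear_congr {d : ℕ} {K : Type u} [Field K] {b b' : ℕ → Fin (d + 1) → K} (h : b = b')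
    (I : Ideal (MvPowerSeries (Fin (d + 1)) K)) :
    I.map (substAlgHom (SeriesGen.hasSubst_shearSubst b)).toRingHom = I.map (substAlgHom (SeriesGen.hasSubst_shearSubst b')).toRingHom := by
  subst h; rfl

/-! ## §2. The tower glue -/

set_option maxHeartbeats 800000 in
-- many dependent families (`R n`, `A n`, instances) in one statement
/-- **G2f, RING LEVEL: BENNETT'S EQUALITY ALONG THE SHEARED ARC FROM A TOWER OF FORMAL FRAMES** — see the module docstring for the data
and the conclusion. [OURS · L1 W4.2; AI-written] [cite: CossartPiltant2009, ch. 3 I.9] [cite: HerrmannIkedaOrbanz1988, Thm. (22.24)] -/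
theorem exists_bennettArc_of_frameTower {K : Type u} [Field K] {d : ℕ}
    (R : ℕ → Type u) [∀ n, CommRing (R n)] [∀ n, IsRegularLocalRing (R n)]
    (hd : ∀ n, (maximalIdeal (R n)).spanFinrank = d + 1)
    (x : ∀ n, Fin (d + 1) → R n) (hx : ∀ n, Ideal.span (Set.range (x n)) = maximalIdeal (R n))
    (A : ℕ → Type u) [∀ n, CommRing (A n)] [∀ n, IsLocalRing (A n)] [∀ n, IsNoetherianRing (A n)]
    (σ : ∀ n, R n →+* A n) (hσ : ∀ n, Function.Surjective (σ n))
    (hsat : ∀ n r, x n 0 * r ∈ RingHom.ker (σ n) → r ∈ RingHom.ker (σ n))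
    (ψ : ∀ n, R n →+* MvPowerSeries (Fin (d + 1)) K) [∀ n, IsLocalHom (ψ n)]
    (hψ0 : ∀ n, ψ n (x n 0) = X 0) (lam : ℕ → Fin (d + 1) → K)
    (hψi : ∀ n i, i ≠ 0 → ψ n (x n i) - X i - C (lam n i) * X 0 ∈ maximalIdeal (MvPowerSeries (Fin (d + 1)) K) ^ 2)
    (hres : ∀ n (a : K), ∃ r : R n, ψ n r - C a ∈ maximalIdeal (MvPowerSeries (Fin (d + 1)) K))
    (ι : ∀ n, R n →+* R (n + 1)) (c : ℕ → Fin (d + 1) → K)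
    (hcomm : ∀ n r, ψ (n + 1) (ι n r) = subst (SeriesGen.transChartSubst (c (n + 1))) (ψ n r))
    (hker : ∀ n, (RingHom.ker (σ n)).map (ι n) ≤ RingHom.ker (σ (n + 1)))
    (hHS : ∀ n, hilbertFun (A n) = hilbertFun (A 0)) :
    ∃ (J : Ideal (MvPowerSeries (Fin (d + 1)) K)) (_ : IsLocalRing (MvPowerSeries (Fin (d + 1)) K ⧸ J))
      (_ : (MvPowerSeries (Fin (d + 1)) K ⧸ J) ≃+* AdicCompletion (maximalIdeal (A 0)) (A 0))
      (_ : ((ArcLimit.arcIdeal d K).map (Ideal.Quotient.mk J)).IsPrime),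
      J ≤ ArcLimit.arcIdeal d K ∧
        hilbertSamuelFun (Localization.AtPrime ((ArcLimit.arcIdeal d K).map (Ideal.Quotient.mk J))) 1 =
          hilbertFun (MvPowerSeries (Fin (d + 1)) K ⧸ J) := by
  haveI : IsRegularLocalRing (MvPowerSeries (Fin (d + 1)) K) := isRegularLocalRing_mvPowerSeries K (Fin (d + 1))
  -- per stage: cotangent hypothesis, local quotient, Hilbert function, saturation (part 1)
  have hcot : ∀ n, maximalIdeal (MvPowerSeries (Fin (d + 1)) K) ≤
      (maximalIdeal (R n)).map (ψ n) ⊔ maximalIdeal (MvPowerSeries (Fin (d + 1)) K) ^ 2 :=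
    fun n => maximalIdeal_le_map_sup_sq_of_rsop (x n) (hx n) (ψ n) (hψ0 n) (lam n) (hψi n)
  have hlocI : ∀ n, IsLocalRing (MvPowerSeries (Fin (d + 1)) K ⧸ (RingHom.ker (σ n)).map (ψ n)) := fun n =>
    (isLocalRing_and_nonempty_frameModelEquiv_of_frame (hd n) (ψ n) (hres n) (hcot n) (σ n) (hσ n)).1
  have hHSI : ∀ n, hilbertFun (MvPowerSeries (Fin (d + 1)) K ⧸ (RingHom.ker (σ n)).map (ψ n)) = hilbertFun (A n) := fun n =>
    hilbertFun_quotient_map_frame_eq (hd n) (ψ n) (hres n) (hcot n) (σ n) (hσ n)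
  have hsatI : ∀ n, ((RingHom.ker (σ n)).map (ψ n)).colon {(X 0 : MvPowerSeries (Fin (d + 1)) K)} =
      (RingHom.ker (σ n)).map (ψ n) := by
    intro n
    refine le_antisymm (fun f hf => ?_) (fun f hf => ?_)
    · rw [Submodule.mem_colon_singleton, smul_eq_mul] at hf
      refine mem_map_frame_of_mul_mem (hd n) (ψ n) (hres n) (hcot n) (hsat n) (f := f) ?_
      rw [hψ0 n]; simpa only [mul_comm] using hf
    · rw [Submodule.mem_colon_singleton, smul_eq_mul]
      exact Ideal.mul_mem_right _ _ hf
  -- the sheared ideals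
  let Jn : ℕ → Ideal (MvPowerSeries (Fin (d + 1)) K) := fun n =>
    ((RingHom.ker (σ n)).map (ψ n)).map (substAlgHom (SeriesGen.hasSubst_shearSubst fun k => c (n + k))).toRingHom
  -- the composite chart steps
  let T : ℕ → (MvPowerSeries (Fin (d + 1)) K →+* MvPowerSeries (Fin (d + 1)) K) := fun n =>
    Nat.rec (RingHom.id _) (fun k Tk => (FormalFrameGen.substHom (c (k + 1))).comp Tk) n
  have hT0 : ∀ g, T 0 g = g := fun g => rfl
  have hT : ∀ n g, T (n + 1) g = subst (SeriesGen.transChartSubst (c (n + 1))) (T n g) := fun n g => by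
    show FormalFrameGen.substHom (c (n + 1)) (T n g) = _
    rw [FormalFrameGen.substHom_apply]
  -- the composite steps carry the base equations into the stage-`n` equations
  have hincl : ∀ n, ((RingHom.ker (σ 0)).map (ψ 0)).map (T n) ≤ (RingHom.ker (σ n)).map (ψ n) := by
    intro n
    induction n with
    | zero =>
      show ((RingHom.ker (σ 0)).map (ψ 0)).map (RingHom.id _) ≤ _
      rw [Ideal.map_id]
    | succ n ih =>
      show ((RingHom.ker (σ 0)).map (ψ 0)).map ((FormalFrameGen.substHom (c (n + 1))).comp (T n)) ≤ _
      have hc : (FormalFrameGen.substHom (c (n + 1))).comp (ψ n) = (ψ (n + 1)).comp (ι n) := by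
        refine RingHom.ext fun r => ?_
        rw [RingHom.comp_apply, RingHom.comp_apply, FormalFrameGen.substHom_apply, hcomm]
      rw [← Ideal.map_map]
      calc (((RingHom.ker (σ 0)).map (ψ 0)).map (T n)).map (FormalFrameGen.substHom (c (n + 1)))
          ≤ ((RingHom.ker (σ n)).map (ψ n)).map (FormalFrameGen.substHom (c (n + 1))) := Ideal.map_mono ih
        _ = ((RingHom.ker (σ n)).map (ι n)).map (ψ (n + 1)) := by rw [Ideal.map_map, Ideal.map_map, hc]
        _ ≤ (RingHom.ker (σ (n + 1))).map (ψ (n + 1)) := Ideal.map_mono (hker n)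
  -- the three hypotheses of G2c
  have hJ0 : Jn 0 = ((RingHom.ker (σ 0)).map (ψ 0)).map (substAlgHom (SeriesGen.hasSubst_shearSubst c)).toRingHom :=
    map_shear_congr (funext fun k => by rw [Nat.zero_add]) _
  have hscale : ∀ n g, g ∈ Jn 0 → subst (ArcLimit.scale d K n) g ∈ Jn n := by
    intro n g hg
    rw [hJ0] at hg
    exact SeriesGen.subst_scale_mem_map_shear c T hT0 hT _ (fun n => (RingHom.ker (σ n)).map (ψ n)) hincl n hg
  have hsatJ : ∀ n f, X 0 * f ∈ Jn n → f ∈ Jn n := by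
    intro n f hf
    have h := SeriesGen.colon_X_zero_map_shear (fun k => c (n + k)) (hsatI n)
    have hf' : f ∈ (Jn n).colon {(X 0 : MvPowerSeries (Fin (d + 1)) K)} := by
      rw [Submodule.mem_colon_singleton, smul_eq_mul]
      simpa only [mul_comm] using hf
    simpa only [Jn, h] using hf'
  haveI hloc : ∀ n, IsLocalRing (MvPowerSeries (Fin (d + 1)) K ⧸ Jn n) := fun n => by
    obtain ⟨e⟩ := SeriesGen.nonempty_ringEquiv_quotient_map_shear (fun k => c (n + k)) ((RingHom.ker (σ n)).map (ψ n))
    haveI := hlocI n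
    exact e.isLocalRing
  have hHSn : ∀ n, hilbertFun (MvPowerSeries (Fin (d + 1)) K ⧸ Jn n) = hilbertFun (A n) := by
    intro n
    obtain ⟨e⟩ := SeriesGen.nonempty_ringEquiv_quotient_map_shear (fun k => c (n + k)) ((RingHom.ker (σ n)).map (ψ n))
    haveI := hlocI n
    haveI : IsLocalRing (MvPowerSeries (Fin (d + 1)) K ⧸ ((RingHom.ker (σ n)).map (ψ n)).map
        (substAlgHom (SeriesGen.hasSubst_shearSubst fun k => c (n + k))).toRingHom) := hloc n
    haveI : IsNoetherianRing (MvPowerSeries (Fin (d + 1)) K ⧸ (RingHom.ker (σ n)).map (ψ n)) := Ideal.Quotient.isNoetherianRing _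
    rw [← hHSI n, hilbertFun_eq_of_ringEquiv e]
  have hHSJ : ∀ n, hilbertFun (MvPowerSeries (Fin (d + 1)) K ⧸ Jn n) = hilbertFun (MvPowerSeries (Fin (d + 1)) K ⧸ Jn 0) :=
    fun n => by rw [hHSn n, hHSn 0, hHS n]
  -- G2c
  have hJP : Jn 0 ≤ ArcLimit.arcIdeal d K := ArcLimit.le_arcIdeal_of_tower hsatJ hscale
  haveI := (ArcLimit.isPrime_arcIdeal (d := d) (K := K))
  haveI hP : ((ArcLimit.arcIdeal d K).map (Ideal.Quotient.mk (Jn 0))).IsPrime :=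
    Ideal.map_isPrime_of_surjective Ideal.Quotient.mk_surjective (by rwa [Ideal.mk_ker])
  have hH := ArcLimit.hilbertSamuelFun_arcLimit hsatJ hscale hHSJ
  -- the formal model of the base stage, sheared
  obtain ⟨Ψ, hΨ⟩ := exists_cohenEquiv_of_frame (hd 0) (ψ 0) (hres 0) (hcot 0)
  obtain ⟨θ, hθ, -⟩ := SeriesGen.exists_ringEquiv_shear (K := K) c
  have hθmap : Jn 0 = ((RingHom.ker (σ 0)).map (ψ 0)).map (θ : MvPowerSeries (Fin (d + 1)) K →+* MvPowerSeries (Fin (d + 1)) K) := by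
    rw [hJ0]
    congr 1
    exact RingHom.ext fun g => by rw [AlgHom.toRingHom_eq_coe, RingHom.coe_coe, substAlgHom_apply, RingHom.coe_coe, hθ]
  obtain ⟨-, ⟨e'⟩⟩ := nonempty_frameModelEquiv_map_of_surjective Ψ (ψ 0) hΨ (σ 0) (hσ 0) θ
  rw [← hθmap] at e'
  exact ⟨Jn 0, hloc 0, e', hP, hJP, hH⟩

end Summit.ResolutionOfSingularities.ResolutionOfSingularities.Theorems.SigmaMaxModificationsCorridor3.IsoTailsHS

end
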